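import Summits.AtomisticToContinuum.BoseEinsteinCondensation.Theorems.LatticeODLROOffHalfFilling.Negative.OffHalfFillingForced

/-!
# Route `BECGroundStateSOS`, crux `LatticeODLROOffHalfFilling` (stmt-AtomisticToContinuum-11033),
# line `Sketch`: the registered stub `stub_sectorGround`

Supports (does not close) stmt-AtomisticToContinuum-11033. A ground vector `v` of
`H_{L,μ} = H_XY − μ S³_tot` (`Hmu L μ`) which is an `S³_tot`-eigenvector with eigenvalue `M` is a
sector ground vector of the XY torus Hamiltonian `H_XY = xyTorus 3 L 1`, with the eigenvalue
written as the sector energy `lowestEnergyInSector 1 (xyTorus 3 L 1) M`.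

Proof: `H_XY v = (E₀ + μM) v` with `E₀ = E₀(H_{L,μ})` (`xy_mulVec_eq`); and `E₀ + μM` is the least
Rayleigh quotient of `H_XY` over unit vectors of the sector `S³_tot = M`: it is attained at the
normalisation of `v`, and for a unit `ψ` in the sector `⟨ψ, H_XY ψ⟩ = ⟨ψ, H_{L,μ} ψ⟩ + μM ≥ E₀ + μM`
by the variational principle (`groundEnergy_le_rayleigh_holds`). No block-diagonality of `H_XY`
is used.
-/

namespace Summit.AtomisticToContinuum.BoseEinsteinCondensation.Theorems.LatticeODLROOffHalfFilling.Ladder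

open Literature.MathematicalPhysics.QuantumLattice Literature.Probability.LatticeModels
open Matrix Finset
-- the sibling toolkit namespace `…Theorems.LatticeODLROOffHalfFilling.Negative` (`Hmu`, …)
open Negative
open scoped ComplexOrder BigOperators

/-- `H_XY ψ = H_{L,μ} ψ + μ S³_tot ψ` (unfolding `Hmu`). [folklore] -/
private theorem xy_mulVec_eq_hmu_add (L : ℕ) [NeZero L] (μ : ℝ)
    (ψ : TensorIndex (TorusSite 3 L) 2 → ℂ) :
    xyTorus 3 L 1 *ᵥ ψ =
      Hmu L μ *ᵥ ψ + (μ : ℂ) • ((totalSpin 1 2 : Op (TorusSite 3 L) 2) *ᵥ ψ) := by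
  rw [Hmu, sub_mulVec, smul_mulVec, sub_add_cancel]

/-- A ground vector `v` of `H_{L,μ}` with `S³_tot v = M v` satisfies `H_XY v = (E₀ + μM) v`,
`E₀ = E₀(H_{L,μ})`. [folklore] -/
private theorem xy_mulVec_eq (L : ℕ) [NeZero L] (μ M : ℝ) (v : TensorIndex (TorusSite 3 L) 2 → ℂ)
    (hv : v ∈ (Hmu L μ).groundSpace)
    (hS : (totalSpin 1 2 : Op (TorusSite 3 L) 2) *ᵥ v = (M : ℂ) • v) :
    xyTorus 3 L 1 *ᵥ v = (((Hmu L μ).groundEnergy + μ * M : ℝ) : ℂ) • v := by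
  rw [mem_groundSpace_iff] at hv
  rw [xy_mulVec_eq_hmu_add L μ v, hv, hS, smul_smul, ← add_smul]
  push_cast
  rfl

/-- For a unit vector `ψ` with `S³_tot ψ = M ψ`:
`Re ⟨ψ, H_XY ψ⟩ = Re ⟨ψ, H_{L,μ} ψ⟩ + μM`. [folklore] -/
private theorem re_rayleigh_xy_eq (L : ℕ) [NeZero L] (μ M : ℝ)
    (ψ : TensorIndex (TorusSite 3 L) 2 → ℂ)
    (hS : (totalSpin 1 2 : Op (TorusSite 3 L) 2) *ᵥ ψ = (M : ℂ) • ψ) (hψ1 : star ψ ⬝ᵥ ψ = 1) :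
    (star ψ ⬝ᵥ xyTorus 3 L 1 *ᵥ ψ).re = (star ψ ⬝ᵥ Hmu L μ *ᵥ ψ).re + μ * M := by
  rw [xy_mulVec_eq_hmu_add L μ ψ, hS, smul_smul, dotProduct_add, dotProduct_smul, hψ1,
    smul_eq_mul, mul_one, Complex.add_re]
  congr 1
  rw [← Complex.ofReal_mul, Complex.ofReal_re]

/-- Normalisation: a nonzero complex vector has a unit multiple (for `star v ⬝ᵥ v`).
[folklore] -/
private theorem exists_smul_dotProduct_eq_one {ι : Type*} [Fintype ι] {v : ι → ℂ} (hv : v ≠ 0) :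
    ∃ c : ℂ, star (c • v) ⬝ᵥ (c • v) = 1 := by
  -- adapted from `exists_smul_unit` (Literature/MathematicalPhysics/QuantumLattice/SectorSpectrum)
  have hpos : 0 < star v ⬝ᵥ v := dotProduct_star_self_pos_iff.2 hv
  obtain ⟨hre, him⟩ := Complex.pos_iff.mp hpos
  set r := Real.sqrt (star v ⬝ᵥ v).re with hr
  have hr0 : 0 < r := Real.sqrt_pos.2 hre
  have hrr : ((r : ℂ)) * r = star v ⬝ᵥ v := by
    apply Complex.ext
    · simp only [Complex.mul_re, Complex.ofReal_re, Complex.ofReal_im, mul_zero, sub_zero]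
      rw [hr, Real.mul_self_sqrt hre.le]
    · simp only [Complex.mul_im, Complex.ofReal_re, Complex.ofReal_im, mul_zero, zero_mul,
        add_zero]
      exact him
  refine ⟨((r : ℂ))⁻¹, ?_⟩
  rw [star_smul, smul_dotProduct, dotProduct_smul, smul_smul, ← hrr, Complex.star_def, map_inv₀,
    Complex.conj_ofReal, smul_eq_mul]
  field_simp [hr0.ne']

/-- **Ground vectors of `H_{L,μ}` in a sector are sector ground vectors of `H_XY`.** [folklore] -/
theorem stub_sectorGround (L : ℕ) [NeZero L] (μ M : ℝ) (v : TensorIndex (TorusSite 3 L) 2 → ℂ)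
    (hv : v ∈ (Hmu L μ).groundSpace)
    (hS : (totalSpin 1 2 : Op (TorusSite 3 L) 2) *ᵥ v = (M : ℂ) • v) (hv0 : v ≠ 0) :
    xyTorus 3 L 1 *ᵥ v = ((lowestEnergyInSector 1 (xyTorus 3 L 1) M : ℝ) : ℂ) • v := by
  have hHv := xy_mulVec_eq L μ M v hv hS
  suffices hE : lowestEnergyInSector 1 (xyTorus 3 L 1) M = (Hmu L μ).groundEnergy + μ * M by
    rw [hE]
    exact hHv
  -- the sector, as an eigenvector equation
  have hmem : ∀ ψ : TensorIndex (TorusSite 3 L) 2 → ℂ,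
      ψ ∈ spinZSector (Λ := TorusSite 3 L) 1 M ↔
        (totalSpin 1 2 : Op (TorusSite 3 L) 2) *ᵥ ψ = (M : ℂ) • ψ := fun ψ => by
    rw [spinZSector, Module.End.mem_eigenspace_iff, Matrix.toLin'_apply]
  rw [lowestEnergyInSector, Matrix.minEnergyOn]
  refine IsLeast.csInf_eq ⟨?_, ?_⟩
  · -- attained at the normalisation of `v`
    obtain ⟨c, hc1⟩ := exists_smul_dotProduct_eq_one hv0
    refine ⟨c • v, Submodule.smul_mem _ c ((hmem v).2 hS), hc1, ?_⟩
    rw [mulVec_smul, hHv, smul_comm, dotProduct_smul, hc1, smul_eq_mul, mul_one,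
      Complex.ofReal_re]
  · -- lower bound: the variational principle for `H_{L,μ}`
    rintro E ⟨ψ, hψ, hψ1, rfl⟩
    rw [re_rayleigh_xy_eq L μ M ψ ((hmem ψ).1 hψ) hψ1]
    have h := groundEnergy_le_rayleigh_holds (Hmu_isHermitian L μ) ψ hψ1
    linarith

end Summit.AtomisticToContinuum.BoseEinsteinCondensation.Theorems.LatticeODLROOffHalfFilling.Ladder
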